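import Summits.BirchSwinnertonDyer.BirchSwinnertonDyer.Theses.ByReductionTypeAtTwo
import Summits.BirchSwinnertonDyer.BirchSwinnertonDyer.Theorems.ByReductionTypeAtTwoSupersingularFlatRoadLineV9
import Summits.BirchSwinnertonDyer.BirchSwinnertonDyer.Theorems.ByReductionTypeAtTwoSupersingularNoPollackPair
import HarnessLib

/-!
# Line `signed-halves-two` (v9, 2026-08-27, seat `bsd-2adic-ss-1` GEN 10; v8/v7 = GEN 9, v6 = GEN 8, v4 = GEN 7, v3 = GEN 3) — skeleton for crux
# `SupersingularRankZeroAtTwo` (item stmt-BirchSwinnertonDyer-19097, route ByReductionTypeAtTwo, rung K4)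

v9 vs v8 (GEN 10): the EC♭@2 conjunct of stub (5) — the ♭ `Γ`-Euler characteristic at `2`, Sprung 2024 §5.2
Lemmas 5.5·5.8·5.9 READ AT 2 — is no longer a stub clause but PRODUCED in the kernel
(`Theorems/ByReductionTypeAtTwoSupersingular{FlatColemanClauses,FlatLocalInjectivity,FlatEulerCharRat,TowerTorsionTwo,
FlatRoadLineV9}.lean`: the K3 lane's `p ≠ 2` kernel theorems for §5.2 PORTED to `p = 2` with the Honda clauses
as explicit binders; Lemma 2.3 AT 2, `Col♭` onto `Λ` AT 2, "`r_2` injective", Lemmas 5.8 × 5.9 at 2 and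
`#E(ℚ)[2^∞] = 1` are theorems). Stub (5) is RESHAPED to `stub_pmFlatDataV9` = ∃ local data with the Honda₂
clauses (levels, `n ≥ 1` trace relation, level-`0` generation ON `d_0 = [−c♭]ε`) ∧ ONE count (Lemma 5.5 at 2
on Sel♭ — where the real place of (14.9.3) lives) ∧ CK♭@2 (verbatim). The other eight stubs are v8 VERBATIM.
(Below, the v8 description.)

The crux (BSD₂ for every non-CM `E/ℚ` of analytic rank `0` with good SUPERSINGULAR reduction at `2`,
`a₂ ∈ {0, ±2}`) from NINE stubs, composed by the LANDED theorem
`Theorems.SSFlatRoad.supersingularRankZeroAtTwo_of_line_flatRoadV8` (`Theorems/ByReductionTypeAtTwoSupersingularFlatRoadLineV8.lean`,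
GEN 9) = p495102's v6 composition with the `a₂ = ±2` UPPER Miller half no longer a stub but PRODUCED by the ♭ Coleman road at `2`
(`Theorems/ByReductionTypeAtTwoSupersingularFlatRoad{,Door,Line}.lean`, GEN 9) from the new ∀-closed stub `stub_pmFlatRoad`.

v8 vs v7: audit-1's ♭ sheet (a7f89bf8669e0411) ask (i) φ♭1 — the CONJECTURE-grade clause «¬TwoAdicSurjective W → μ(X♭) = 0» is SPLIT OUT
of the ∃-stub as `stub_pmMuFlatOfNonSurj`, GUARDED by EC♭ ∧ CK♭ on the same data (a bare ∀ over junk data would be false); `stub_pmFlatData` =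
v7's `stub_pmFlatRoad` minus that clause. v7 vs v6 (why: the tree now holds Sprung's ♯/♭ vocabulary — `Sprung2012.SharpFlatSelmerDualData`, `IsColemanPair`, `Ker Col^•`,
`SharpFlatSelmerDualData.moduleFinite`, `nonempty_sharpFlatSelmerDualData`, typed 2026-08-26 by cell bsd-ssimc for K3 — so the `a₂ = ±2`
sub-row (549 r0 classes) admits the SAME road as `a₂ = 0`, with Kobayashi's `X⁺` ↦ Sprung's `X^♭`, Pollack pair ↦ Sprung pair at `2`
(`exists_isSprungPair_two`), Kim EC ↦ Sprung 2024 §5.2 L5.5·5.8·5.9, and the `2`-adic UNIT `c♭ = −a₂² + 2a₂ + 1 ∈ {1, −7}`):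
* `stub_pmFlatRoad` (NEW): for every curve of the `a₂ = ±2` sub-row, cyclotomic datum matching the variable and place `v ∋ 2`, THERE ARE
  local Coleman data `(g, c)` at `v` (`g` a local lift of `γ`; in print: Sprung's Honda system at `2`, J. Number Theory 132 Thm. 2.2 (2′), with his
  Coleman maps at `2`, §§2–6 — NO Honda predicate at `2` is asserted, the tree's `IsHondaSystem` being the odd-`p` form) such that
  EC♭@2 [Sprung 2024 L5.5·5.8·5.9 READ AT 2] ∧ CK♭@2 [F1♭ Prop. 7.19 exactness incl. the `Δ = {±1}` descent · F3♭ `ι G = ϖ·ι L♭` (Sprung Def. 6.1 /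
  Prop. 6.3–6.5, §§2–6 include `p = 2`) · F4rat (Kato 12.5 (3)) · `TwoAdicSurjective W →` F4@(2) (Kato 12.5 (4) at 2, Kurihara–Otsuki p. 564)] ∧
  (`¬ TwoAdicSurjective W →` μ♭ = 0). All 549 classes `N < 5·10⁵` are `2`-adically surjective (DD certificates, census work/classes/census_pm2.json).
* `stub_pmMillerLower` (= the LOWER conjunct of v6's `stub_traceTwoMillerHalves`): Miller's lower half `ord₂ #Ш_an ≤ ord₂ #Ш` on `a₂ = ±2` —
  certificate-shaped per class (CERT-CT2-X5ALL / CERT-L3-CT42), conjecture-shaped as ∀, exactly like the `a₂ = 0` descent half.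
* unchanged (v6 verbatim): `stub_ssPub`, `stub_katoPub`, `stub_zeroSignedEulerChar`, `stub_zeroKobayashiLower` (HARDEST), `stub_zeroColemanKato`, `stub_zeroMuPlusOfNonSurj`.
After v7: a₂ = 0 — P-at-2 {F3a, F3b, F4rat} + READ-AT-2 {F1 memo (LAG), F4@(2) P-ASSERT} + PUB + stub (2) + μ⁺ = 0 ×2 + CERT;
**a₂ = ±2 — PRINT-at-2 {Sprung Thm. 2.2 (2′), Col at 2 §§2–6, Sprung pair at 2} + READ-AT-2 {F1♭ (Prop. 7.19 + Δ-descent, no memo yet), F3♭, F4@(2)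
P-ASSERT, EC♭ (L5.5·5.8·5.9)} + P {F4rat} + PUB + CERT — no longer MATH-BOUND on the Kato half; the lower half certificate-shaped per class.**

History: v1 (GEN 2, 5 stubs); v2/v3 (GEN 3); v4 (GEN 7: Coleman–Kato package); v5 (GEN 8: print scope); v6 (GEN 8: F3c print-read, `μ` stub);
v7 (this file: the ♭ road on `a₂ = ±2`).

Census (planner, eng2/x5_by_type_at_2.json): 763 X5@2 good-ss classes = a₂ = 0: 208 (all r0; 206 `ρ_{E,2^∞}` onto + 2 not) ·
a₂ = +2: 486 (483 r0 + 3 r1) · a₂ = −2: 69 (66 r0 + 3 r1); the crux's class is the 757 r0 ones (a₂ = ±2 r0: 549, all `ρ_{E,2^∞}` onto).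
-/

set_option autoImplicit false
-- the Cruxes namespace of this sub repeats the summit name by design (D-0017 nested layout)
set_option linter.dupNamespace false

open scoped NumberField

open CongruenceSubgroup WeierstrassCurve Literature.NumberTheory.EllipticCurves
  Literature.NumberTheory.EllipticCurves.ModularForms
  Literature.NumberTheory.EllipticCurves.Rank1Residual Literature.NumberTheory.EllipticCurves.Rank1Residual.Typed
  Literature.NumberTheory.EllipticCurves.Kobayashi2003 Literature.NumberTheory.EllipticCurves.Sprung2012
  Literature.NumberTheory.EllipticCurves.Sprung2017 Literature.NumberTheory.EllipticCurves.IwasawaDual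
  Literature.NumberTheory.GaloisRepresentations ZpExtension NumberField IsDedekindDomain
  Summit.BirchSwinnertonDyer.Rank1Residual.Supersingular Summit.BirchSwinnertonDyer.Rank1Residual.X5.O1

namespace Summit.BirchSwinnertonDyer.BirchSwinnertonDyer.Cruxes.SupersingularRankZeroAtTwo

namespace SignedHalvesTwo

/-- stub (1): the two PUBLISHED inputs, modularity ∧ GZK (closed by citation; route items 19266 / 19921). -/
theorem stub_ssPub :
    nonempty_modularParametrizationData ∧ rank_eq_analyticRank_of_analyticRank_le_one := by
  sorry

/-- stub (1′): PUBLISHED — Kato, Astérisque 295 Thm. 12.4 (2) (`𝐇¹_Γ(T_pW)` torsion free of rank `1`) and Thm. 12.4 (1) ∘ (17.13.1)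
(`X⁰(E/ℚ_∞)` is `Λ`-torsion): the tree's two accepted named facts, any `p`. Closed by citation. -/
theorem stub_katoPub : Kato2004.thm12_4 ∧ Kato2004_fineSelmerDual_isTorsion := by
  sorry

/-- stub (2): `a₂ = 0` — B. D. Kim's signed `Γ`-Euler characteristic at `2` on `S = Sel⁺(E/ℚ_∞)`:
`Sel_{2^∞}(E/ℚ)` finite ⇒ `S^Γ` finite and `#S^Γ = u · 2^{v₂ ∏c_ℓ} · #Sel_{2^∞}(E/ℚ) · #S_Γ`, `u ∈ ℤ₂ˣ`. -/
theorem stub_zeroSignedEulerChar :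
    ∀ (W : WeierstrassCurve ℚ) [W.IsElliptic] [W.IsGloballyMinimal],
      ¬ W.HasCM → W.analyticRank = 0 → GoodSS W 2 → W.frobeniusTrace 2 = 0 →
      ∀ (κ : ZpExtension ℚ 2) (γ : Field.absoluteGaloisGroup ℚ),
        κ.IsCyclotomic → κ.IsTopGenerator γ → Finite (W.selmerGroupPInfty 2) →
        Finite (endInvariants (conjSignedSelmerInfty W κ 1 γ - 1)) ∧
          ∃ u : ℤ_[2]ˣ, (Nat.card (endInvariants (conjSignedSelmerInfty W κ 1 γ - 1)) : ℚ_[2]) =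
            ((u : ℤ_[2]) : ℚ_[2]) * ((2 : ℕ) : ℚ_[2]) ^ (padicValNat 2 W.tamagawaProduct) *
              (Nat.card (W.selmerGroupPInfty 2) : ℚ_[2]) *
                (Nat.card (EndCoinvariants (conjSignedSelmerInfty W κ 1 γ - 1)) : ℚ_[2]) := by
  sorry

/-- stub (3): `a₂ = 0` — the Eisenstein half `SS.KobayashiLowerDivisibility W 2 1` (HARDEST). -/
theorem stub_zeroKobayashiLower :
    ∀ (W : WeierstrassCurve ℚ) [W.IsElliptic] [W.IsGloballyMinimal],
      ¬ W.HasCM → W.analyticRank = 0 → GoodSS W 2 → W.frobeniusTrace 2 = 0 →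
        KobayashiLowerDivisibility W 2 1 := by
  sorry

/-- stub (4): `a₂ = 0` — THE COLEMAN–KATO PACKAGE AT `2`, v6: for every curve of the sub-row, cyclotomic datum matching the variable,
newform, period ratio, Pollack pair at `2` and dual datum `D` of `Sel⁺(E/ℚ_∞)`, there are pinned `I = 𝐇¹_Γ(T₂W)`, `Y = X⁰(E/ℚ_∞)`,
`P = im Col⁺ ≤ Λ`, maps `loc, toX, δ`, the zeta submodule `Z ≤ 𝐇¹` and `G ∈ Λ` with F1 (7.21)@2 `Exact loc toX ∧ Exact toX δ` [memo] ·
F3a `G ∈ Col⁺(loc Z)` [Sprung Def. 6.1 at 2] · F3b `ι G = ϖ·ι L♭` EXACT [P-READ on Λ_Γ: Kato §13.8/§13.14, no image guard] · F4rat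
`length_𝔭 X⁰ ≤ length_𝔭 𝐇¹/Z` at every height-one `𝔭 ∌ 2` [Kato 12.5 (3)] · GUARDED `TwoAdicSurjective W → F4 at the height-one 𝔭 ∋ 2`
[Kurihara–Otsuki p. 564: Kato 12.5 (4) at 2 under (12.5.2)]. -/
theorem stub_zeroColemanKato :
    ∀ (W : WeierstrassCurve ℚ) [W.IsElliptic] [W.IsGloballyMinimal],
      ¬ W.HasCM → W.analyticRank = 0 → GoodSS W 2 → W.frobeniusTrace 2 = 0 →
      ∀ (κ : ZpExtension ℚ 2) (γ : Field.absoluteGaloisGroup ℚ),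
        κ.IsCyclotomic → κ.IsTopGenerator γ → IsCyclotomicVariable 2 γ →
        ∀ [NeZero (W.conductorNorm ℤ)] (f : CuspForm (Gamma0 (W.conductorNorm ℤ)) 2),
          IsNewformOf W f → ∀ (ϖ : ℚ), (ϖ : ℝ) * W.realPeriodRat = plusPeriod f →
        ∀ (Lplus Lminus : IwasawaAlgebra 2), IsPollackPair f 2 Lplus Lminus →
        ∀ (D : SignedSelmerDualData W κ γ 1) [ContinuousSMul ℤ_[2] (W.tateModule 2)],
          ∃ (I : Kato2004.IwasawaH1Data W 2 κ γ) (Y : W.FineSelmerDualData κ γ)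
            (P : Submodule (IwasawaAlgebra 2) (IwasawaAlgebra 2))
            (loc : I.H →ₗ[IwasawaAlgebra 2] P) (toX : P →ₗ[IwasawaAlgebra 2] D.X)
            (δ : D.X →ₗ[IwasawaAlgebra 2] Y.X) (Z : Submodule (IwasawaAlgebra 2) I.H)
            (G : IwasawaAlgebra 2),
            Function.Exact loc toX ∧ Function.Exact toX δ ∧
            G ∈ Submodule.map (P.subtype ∘ₗ loc) Z ∧
            iwasawaToPowerSeries 2 G =
              PowerSeries.C (ϖ : ℚ_[2]) * iwasawaToPowerSeries 2 (kobayashiL 1 Lplus Lminus) ∧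
            (∀ 𝔭 : PrimeSpectrum (IwasawaAlgebra 2), 𝔭.asIdeal.height = 1 →
              PowerSeries.C (2 : ℤ_[2]) ∉ 𝔭.asIdeal →
              Literature.NumberTheory.EllipticCurves.Module.lengthAt (IwasawaAlgebra 2) Y.X 𝔭 ≤
                Literature.NumberTheory.EllipticCurves.Module.lengthAt (IwasawaAlgebra 2) (I.H ⧸ Z) 𝔭) ∧
            (TwoAdicSurjective W →
              ∀ 𝔭 : PrimeSpectrum (IwasawaAlgebra 2), 𝔭.asIdeal.height = 1 →
                PowerSeries.C (2 : ℤ_[2]) ∈ 𝔭.asIdeal →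
                Literature.NumberTheory.EllipticCurves.Module.lengthAt (IwasawaAlgebra 2) Y.X 𝔭 ≤
                  Literature.NumberTheory.EllipticCurves.Module.lengthAt (IwasawaAlgebra 2) (I.H ⧸ Z) 𝔭) := by
  sorry

/-- stub (4′): `a₂ = 0`, `2`-adically NON-surjective image (2/208 classes: 107217l, 184041bk) — `μ(X⁺(E/ℚ_∞)) = 0`: no generator of the
characteristic ideal of the dual `Sel⁺(E/ℚ_∞)` datum is divisible by `2` (CONJECTURE / MATH-BOUND; the `hμ` binder of the rational road
`SSColemanRoad.exists_mul_eq_of_colemanSkeletonRatV5_of_mu`; no printed road at any `p` without big image, no certificate). -/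
theorem stub_zeroMuPlusOfNonSurj :
    ∀ (W : WeierstrassCurve ℚ) [W.IsElliptic] [W.IsGloballyMinimal],
      ¬ W.HasCM → W.analyticRank = 0 → GoodSS W 2 → W.frobeniusTrace 2 = 0 →
      ¬ TwoAdicSurjective W →
      ∀ (κ : ZpExtension ℚ 2) (γ : Field.absoluteGaloisGroup ℚ),
        κ.IsCyclotomic → κ.IsTopGenerator γ → IsCyclotomicVariable 2 γ →
        ∀ (D : SignedSelmerDualData W κ γ 1) (g : IwasawaAlgebra 2),
          D.charIdeal = Ideal.span {g} → ¬ PowerSeries.C (2 : ℤ_[2]) ∣ g := by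
  sorry

/-- stub (5): `a₂ = ±2` — THE ♭ COLEMAN ROAD AT `2`, DATA + COUNT + PACKAGE (v9 = v8's stub (5) with the
EC♭@2 package REPLACED by what produces it): for every curve of the sub-row, cyclotomic datum matching the
variable and place `v ∋ 2` there are local Coleman data `(g, c)` at `v` — `g` a local lift of `γ`, `c` the
Δ-traced Honda system of Sprung's Thm. 2.2 at `p = 2` ((2′), `N = n + 2`; Sprung's `X^♭(E/ℚ_∞)` is DEFINED
through them) — with: LEVELS `c_n ∈ E(ℚ_{2,n})` and the TRACE relation `Tr_{n+1/n} c_{n+1} = a₂ c_n − c_{n−1}`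
for `n ≥ 1` [PRINT-at-2, Thm. 2.2 traced]; the level-`0` GENERATION clause ON `c_0 = d_0 = [−c♭]ε`
(`c♭ = −a₂² + 2a₂ + 1 ∈ {1, −7}` a `2`-adic unit, `ε` a generator of `Ê(ℚ₂)`) in dual form — evaluation at
`c_0` is injective on `Hom(E(ℚ₂), ℤ₂)` with `2`-saturated image [DERIVED: MEMO-F1flat-gen9 / audit-1 ♭ sheet
a7f89bf8, Sprung's table p. 1498]; the COUNT of Sprung 2024 Lemma 5.5 READ AT 2 on Sel♭
(`#(A♭_0/Sel_0) · #E[2^∞]^{Γ_ℚ} = 2^{ord₂ ∏ c_ℓ} · #(Sel♭_∞)_γ`; Greenberg LNM 1716 Lemmas 4.4 + 4.7 /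
Cassels–Poitou–Tate with `Sel ↦ Sel♭`; the real place of Kato's (14.9.3) «exact up to ×2 in the case
p = 2» lives HERE and only here); and CK♭@2 (v8 VERBATIM: F1♭ · F3♭ · F4rat · `TwoAdicSurjective W →`
F4@(2)). From these the EC♭@2 package of v8 is a THEOREM (`SSFlatRoad.flatEulerChar_two`, GEN 10: Lemma
2.3 at 2, `Col♭` onto `Λ` at 2, "`r_2` injective", Lemmas 5.8 × 5.9, `#E(ℚ)[2^∞] = 1` all in the kernel). -/
theorem stub_pmFlatDataV9 :
      ∀ (W : WeierstrassCurve ℚ) [W.IsElliptic] [W.IsGloballyMinimal],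
      ¬ W.HasCM → W.analyticRank = 0 → GoodSS W 2 → (W.frobeniusTrace 2 = 2 ∨ W.frobeniusTrace 2 = -2) →
      ∀ (κ : ZpExtension ℚ 2) (γ : Field.absoluteGaloisGroup ℚ),
        κ.IsCyclotomic → κ.IsTopGenerator γ → IsCyclotomicVariable 2 γ →
      ∀ (v : HeightOneSpectrum (𝓞 ℚ)), (2 : 𝓞 ℚ) ∈ v.asIdeal →
      ∃ (g : Field.absoluteGaloisGroup (v.adicCompletion ℚ)) (c : ℕ → localPoints W (v.adicCompletion ℚ)),
        κ.IsTopGenerator (resGalOfEmb (closureEmb (K := ℚ) (v.adicCompletion ℚ)) g) ∧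
        (∀ n, c n ∈ localLayerPointsOfEmb κ (closureEmb (K := ℚ) (v.adicCompletion ℚ)) W n) ∧
        (∀ n, 1 ≤ n → localTraceOfEmb κ (closureEmb (K := ℚ) (v.adicCompletion ℚ)) W n (n + 1)
          (c (n + 1)) = W.frobeniusTrace 2 • c n - c (n - 1)) ∧
        (∀ z₀ : localLayerPointsOfEmb κ (closureEmb (K := ℚ) (v.adicCompletion ℚ)) W 0 →+ ℤ_[2],
          evalOn W (localLayerPointsOfEmb κ (closureEmb (K := ℚ) (v.adicCompletion ℚ)) W 0) z₀ (c 0) = 0 →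
            z₀ = 0) ∧
        (∀ a : ℤ_[2],
          (∃ z₀ : localLayerPointsOfEmb κ (closureEmb (K := ℚ) (v.adicCompletion ℚ)) W 0 →+ ℤ_[2],
            evalOn W (localLayerPointsOfEmb κ (closureEmb (K := ℚ) (v.adicCompletion ℚ)) W 0) z₀ (c 0) =
              2 * a) →
          ∃ y : localLayerPointsOfEmb κ (closureEmb (K := ℚ) (v.adicCompletion ℚ)) W 0 →+ ℤ_[2],
            evalOn W (localLayerPointsOfEmb κ (closureEmb (K := ℚ) (v.adicCompletion ℚ)) W 0) y (c 0) = a) ∧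
        (Finite (W.selmerGroupPInfty 2) →
          Finite (EndCoinvariants (conjSharpFlatSelmerInfty W κ (closureEmb (K := ℚ) (v.adicCompletion ℚ))
            (W.frobeniusTrace 2) g c .flat γ - 1)) →
          Nat.card (↥((sharpFlatSelmerInfty W κ (closureEmb (K := ℚ) (v.adicCompletion ℚ))
                (W.frobeniusTrace 2) g c .flat).comap (W.layerToInfty κ 0)) ⧸
              (W.selmerLayer κ 0).addSubgroupOf
                ((sharpFlatSelmerInfty W κ (closureEmb (K := ℚ) (v.adicCompletion ℚ))
                  (W.frobeniusTrace 2) g c .flat).comap (W.layerToInfty κ 0))) *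
            Nat.card (MulAction.fixedPoints (Field.absoluteGaloisGroup ℚ) (W.geomPrimaryTorsion 2)) =
          2 ^ (padicValNat 2 W.tamagawaProduct) *
            Nat.card (EndCoinvariants (conjSharpFlatSelmerInfty W κ
              (closureEmb (K := ℚ) (v.adicCompletion ℚ)) (W.frobeniusTrace 2) g c .flat γ - 1))) ∧
        (∀ [NeZero (W.conductorNorm ℤ)] (f : CuspForm (Gamma0 (W.conductorNorm ℤ)) 2),
            IsNewformOf W f → ∀ (ϖ : ℚ), (ϖ : ℝ) * W.realPeriodRat = plusPeriod f →
          ∀ (Ls Lf : IwasawaAlgebra 2), IsSprungPair f 2 (W.frobeniusTrace 2) Ls Lf →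
          ∀ (D : SharpFlatSelmerDualData W κ γ (closureEmb (K := ℚ) (v.adicCompletion ℚ))
              (W.frobeniusTrace 2) g c .flat) [ContinuousSMul ℤ_[2] (W.tateModule 2)],
            ∃ (I : Kato2004.IwasawaH1Data W 2 κ γ) (Y : W.FineSelmerDualData κ γ)
              (P : Submodule (IwasawaAlgebra 2) (IwasawaAlgebra 2))
              (loc : I.H →ₗ[IwasawaAlgebra 2] P) (toX : P →ₗ[IwasawaAlgebra 2] D.X)
              (δ : D.X →ₗ[IwasawaAlgebra 2] Y.X) (Z : Submodule (IwasawaAlgebra 2) I.H)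
              (G : IwasawaAlgebra 2),
              Function.Exact loc toX ∧ Function.Exact toX δ ∧
              G ∈ Submodule.map (P.subtype ∘ₗ loc) Z ∧
              iwasawaToPowerSeries 2 G = PowerSeries.C (ϖ : ℚ_[2]) * iwasawaToPowerSeries 2 Lf ∧
              (∀ 𝔭 : PrimeSpectrum (IwasawaAlgebra 2), 𝔭.asIdeal.height = 1 →
                PowerSeries.C (2 : ℤ_[2]) ∉ 𝔭.asIdeal →
                Literature.NumberTheory.EllipticCurves.Module.lengthAt (IwasawaAlgebra 2) Y.X 𝔭 ≤
                  Literature.NumberTheory.EllipticCurves.Module.lengthAt (IwasawaAlgebra 2) (I.H ⧸ Z) 𝔭) ∧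
              (TwoAdicSurjective W →
                ∀ 𝔭 : PrimeSpectrum (IwasawaAlgebra 2), 𝔭.asIdeal.height = 1 →
                  PowerSeries.C (2 : ℤ_[2]) ∈ 𝔭.asIdeal →
                  Literature.NumberTheory.EllipticCurves.Module.lengthAt (IwasawaAlgebra 2) Y.X 𝔭 ≤
                    Literature.NumberTheory.EllipticCurves.Module.lengthAt (IwasawaAlgebra 2) (I.H ⧸ Z) 𝔭)) := by
  sorry

/-- stub (5′): `a₂ = ±2`, `2`-adically NON-surjective image (0/549 classes `N < 5·10⁵`; nonempty in general) — `μ(X^♭(E/ℚ_∞)) = 0` for every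
local Coleman datum `(g, c)` CARRYING EC♭@2 ∧ CK♭@2 (the guard makes `X^♭` the torsion module of the road; a bare ∀ over junk data would be
false): CONJECTURE / MATH-BOUND, the ♭ twin of `stub_zeroMuPlusOfNonSurj`. -/
theorem stub_pmMuFlatOfNonSurj :
      ∀ (W : WeierstrassCurve ℚ) [W.IsElliptic] [W.IsGloballyMinimal],
      ¬ W.HasCM → W.analyticRank = 0 → GoodSS W 2 → (W.frobeniusTrace 2 = 2 ∨ W.frobeniusTrace 2 = -2) →
      ∀ (κ : ZpExtension ℚ 2) (γ : Field.absoluteGaloisGroup ℚ),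
        κ.IsCyclotomic → κ.IsTopGenerator γ → IsCyclotomicVariable 2 γ →
      ∀ (v : HeightOneSpectrum (𝓞 ℚ)), (2 : 𝓞 ℚ) ∈ v.asIdeal →
      ∀ (g : Field.absoluteGaloisGroup (v.adicCompletion ℚ)) (c : ℕ → localPoints W (v.adicCompletion ℚ)),
        κ.IsTopGenerator (resGalOfEmb (closureEmb (K := ℚ) (v.adicCompletion ℚ)) g) →
        (∀ (D : SharpFlatSelmerDualData W κ γ (closureEmb (K := ℚ) (v.adicCompletion ℚ))
            (W.frobeniusTrace 2) g c .flat) [Module.Finite (IwasawaAlgebra 2) D.X],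
          Module.IsTorsion (IwasawaAlgebra 2) D.X →
          ∀ f : IwasawaAlgebra 2, D.charIdeal = Ideal.span {f} → Finite (W.selmerGroupPInfty 2) →
            ∃ u : ℤ_[2]ˣ, ((PowerSeries.constantCoeff f : ℤ_[2]) : ℚ_[2]) =
              ((u : ℤ_[2]) : ℚ_[2]) * ((2 : ℕ) : ℚ_[2]) ^ (padicValNat 2 W.tamagawaProduct) *
                (Nat.card (W.selmerGroupPInfty 2) : ℚ_[2])) →
        (∀ [NeZero (W.conductorNorm ℤ)] (f : CuspForm (Gamma0 (W.conductorNorm ℤ)) 2),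
            IsNewformOf W f → ∀ (ϖ : ℚ), (ϖ : ℝ) * W.realPeriodRat = plusPeriod f →
          ∀ (Ls Lf : IwasawaAlgebra 2), IsSprungPair f 2 (W.frobeniusTrace 2) Ls Lf →
          ∀ (D : SharpFlatSelmerDualData W κ γ (closureEmb (K := ℚ) (v.adicCompletion ℚ))
              (W.frobeniusTrace 2) g c .flat) [ContinuousSMul ℤ_[2] (W.tateModule 2)],
            ∃ (I : Kato2004.IwasawaH1Data W 2 κ γ) (Y : W.FineSelmerDualData κ γ)
              (P : Submodule (IwasawaAlgebra 2) (IwasawaAlgebra 2))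
              (loc : I.H →ₗ[IwasawaAlgebra 2] P) (toX : P →ₗ[IwasawaAlgebra 2] D.X)
              (δ : D.X →ₗ[IwasawaAlgebra 2] Y.X) (Z : Submodule (IwasawaAlgebra 2) I.H)
              (G : IwasawaAlgebra 2),
              Function.Exact loc toX ∧ Function.Exact toX δ ∧
              G ∈ Submodule.map (P.subtype ∘ₗ loc) Z ∧
              iwasawaToPowerSeries 2 G = PowerSeries.C (ϖ : ℚ_[2]) * iwasawaToPowerSeries 2 Lf ∧
              (∀ 𝔭 : PrimeSpectrum (IwasawaAlgebra 2), 𝔭.asIdeal.height = 1 →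
                PowerSeries.C (2 : ℤ_[2]) ∉ 𝔭.asIdeal →
                Literature.NumberTheory.EllipticCurves.Module.lengthAt (IwasawaAlgebra 2) Y.X 𝔭 ≤
                  Literature.NumberTheory.EllipticCurves.Module.lengthAt (IwasawaAlgebra 2) (I.H ⧸ Z) 𝔭) ∧
              (TwoAdicSurjective W →
                ∀ 𝔭 : PrimeSpectrum (IwasawaAlgebra 2), 𝔭.asIdeal.height = 1 →
                  PowerSeries.C (2 : ℤ_[2]) ∈ 𝔭.asIdeal →
                  Literature.NumberTheory.EllipticCurves.Module.lengthAt (IwasawaAlgebra 2) Y.X 𝔭 ≤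
                    Literature.NumberTheory.EllipticCurves.Module.lengthAt (IwasawaAlgebra 2) (I.H ⧸ Z) 𝔭)) →
        ¬ TwoAdicSurjective W →
          ∀ (D : SharpFlatSelmerDualData W κ γ (closureEmb (K := ℚ) (v.adicCompletion ℚ))
              (W.frobeniusTrace 2) g c .flat) (g' : IwasawaAlgebra 2),
            D.charIdeal = Ideal.span {g'} → ¬ PowerSeries.C (2 : ℤ_[2]) ∣ g' := by
  sorry

/-- stub (6): `a₂ = ±2` — Miller's LOWER half `ord₂ #Ш_an ≤ ord₂ #Ш` (the lower conjunct of v6's `stub_traceTwoMillerHalves`;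
certificate-shaped per class — CERT-CT2-X5ALL `Ш[2] ⊂ 2Ш[4]` ⇒ `2⁴ ∣ #Ш` on the 507 classes with `#Ш_an = 16`, CERT-L3-CT42 beyond —
conjecture-shaped as ∀, exactly like the `a₂ = 0` descent half). -/
theorem stub_pmMillerLower :
    ∀ (W : WeierstrassCurve ℚ) [W.IsElliptic] [W.IsGloballyMinimal],
      ¬ W.HasCM → W.analyticRank = 0 → GoodSS W 2 →
        (W.frobeniusTrace 2 = 2 ∨ W.frobeniusTrace 2 = -2) → MissingLowerBoundAt W 2 := by
  sorry

/-- composition = THE SKELETON (v9): the crux BY NAME from exactly the nine registered stubs (the two PUB slots paired), by the landed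
`SSFlatRoad.supersingularRankZeroAtTwo_of_line_flatRoadV9` (GEN 10) = v8's composition with slot (5) fed by
`SSFlatRoad.flatData_of_flatDataV9` (EC♭@2 PRODUCED by `SSFlatRoad.flatEulerChar_two`); kernel-checked, no sorry of its own. -/
theorem SupersingularRankZeroAtTwo_of :
    Summit.BirchSwinnertonDyer.BirchSwinnertonDyer.Theses.ByReductionTypeAtTwo.SupersingularRankZeroAtTwo :=
  Summit.BirchSwinnertonDyer.BirchSwinnertonDyer.Theorems.SSFlatRoad.supersingularRankZeroAtTwo_of_line_flatRoadV9
    ⟨stub_ssPub, stub_katoPub⟩ stub_zeroSignedEulerChar stub_zeroKobayashiLower stub_zeroColemanKato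
    stub_zeroMuPlusOfNonSurj stub_pmFlatDataV9 stub_pmMuFlatOfNonSurj stub_pmMillerLower

end SignedHalvesTwo

end Summit.BirchSwinnertonDyer.BirchSwinnertonDyer.Cruxes.SupersingularRankZeroAtTwo
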